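import Mathlib.MeasureTheory.Measure.Portmanteau
import Literature.Probability.RandomPlanarGeometry.CurveSpace

/-!
# Port transfer, part C: convergence in law passes along couplings at vanishing distance

Helper file of the line `Sketch` for the crux `HexTransfer` (stmt-CriticalPhenomena-14221), stub
`stub_portTransfer`. The abstract weak-limit transfer behind "the compass SAW and the Yang–Baxter
walk have the same scaling limit":

* `tendstoLaw_of_dist_le` — let `Y δ, Y' δ : Ωδ δ → X` be two families of random variables on
  the SAME sample spaces with laws `P δ`, with values in a (pseudo-)metric Borel space `X`, and
  `Z` a random variable under a probability measure `P'`. Assume each `P δ` is either the zero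
  measure or a probability measure, `dist (Y δ ω) (Y' δ ω) ≤ ε δ` for all `ω` with `ε δ → 0` as
  `δ → 0⁺`, and `Y' δ → Z` in law (`TendstoLaw`, bounded continuous test functions, along
  `𝓝[>] 0`). Then `Y δ → Z` in law.

Proof: testing against the constant `1` shows that `P δ` is eventually a probability measure; for a
bounded LIPSCHITZ test function the two integrals differ by at most `L ε δ → 0`; Mathlib's
portmanteau implication `MeasureTheory.tendsto_iff_forall_lipschitz_integral_tendsto` (weak
convergence of probability measures is tested on bounded Lipschitz functions) upgrades this to all
bounded continuous test functions. Billingsley, *Convergence of probability measures* (2nd ed.),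
Thm 2.1 and Thm 3.1 (converging together); tagged [folklore].
-/

noncomputable section

namespace Summit.CriticalPhenomena.SAWScalingLimit.Cruxes.HexTransfer.Sketch.PortTransfer

open MeasureTheory Filter Topology Set
open scoped BoundedContinuousFunction NNReal
open Literature.Probability.RandomPlanarGeometry

variable {Ωδ : ℝ → Type*} [∀ δ, MeasurableSpace (Ωδ δ)] {Ω' : Type*} [MeasurableSpace Ω']
  {X : Type*} [PseudoMetricSpace X] [MeasurableSpace X] [BorelSpace X]

/-- A bounded continuous function of an a.e.-measurable random variable is integrable under a
finite measure. [folklore] -/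
theorem integrable_comp_boundedContinuous {Ω : Type*} [MeasurableSpace Ω] {μ : Measure Ω}
    [IsFiniteMeasure μ] (f : X →ᵇ ℝ) {Y : Ω → X} (hY : AEMeasurable Y μ) :
    Integrable (fun ω => f (Y ω)) μ :=
  Integrable.of_bound (f.continuous.measurable.comp_aemeasurable hY).aestronglyMeasurable ‖f‖
    (ae_of_all _ fun ω => f.norm_coe_le_norm (Y ω))

/-- For a bounded `L`-Lipschitz test function and a measure `P` which is `0` or a probability
measure, the integrals of `f ∘ Y` and `f ∘ Y'` differ by at most `L ε` when `dist (Y ω) (Y' ω) ≤ ε`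
pointwise. [folklore] -/
theorem norm_integral_sub_integral_le {Ω : Type*} [MeasurableSpace Ω] {P : Measure Ω}
    (hP : P = 0 ∨ IsProbabilityMeasure P) {Y Y' : Ω → X} (hY : AEMeasurable Y P)
    (hY' : AEMeasurable Y' P) (f : X →ᵇ ℝ) {L : ℝ≥0} (hL : LipschitzWith L f) {ε : ℝ}
    (hd : ∀ ω, dist (Y ω) (Y' ω) ≤ ε) :
    ‖(∫ ω, f (Y ω) ∂P) - ∫ ω, f (Y' ω) ∂P‖ ≤ L * |ε| := by
  rcases hP with h0 | hp
  · simp only [h0, integral_zero_measure, sub_self, norm_zero]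
    positivity
  · rw [← integral_sub (integrable_comp_boundedContinuous f hY)
      (integrable_comp_boundedContinuous f hY')]
    calc ‖∫ ω, (f (Y ω) - f (Y' ω)) ∂P‖ ≤ (L * |ε|) * P.real univ :=
          norm_integral_le_of_norm_le_const (ae_of_all _ fun ω => ?_)
      _ = L * |ε| := by simp
    rw [← dist_eq_norm]
    calc dist (f (Y ω)) (f (Y' ω)) ≤ L * dist (Y ω) (Y' ω) := hL.dist_le_mul _ _
      _ ≤ L * |ε| := by
          gcongr
          exact (hd ω).trans (le_abs_self _)

/-- **Converging together along `δ → 0⁺`.** If each `P δ` is `0` or a probability measure,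
`dist (Y δ ω) (Y' δ ω) ≤ ε δ` with `ε δ → 0`, and `Y' δ → Z` in law under `P δ` along `𝓝[>] 0`
(with `Z` under a probability measure `P'`), then `Y δ → Z` in law (Billingsley, *Convergence of
probability measures*, Thm 3.1, through the bounded-Lipschitz portmanteau criterion,
`MeasureTheory.tendsto_iff_forall_lipschitz_integral_tendsto`). [folklore] -/
theorem tendstoLaw_of_dist_le {Y Y' : ∀ δ, Ωδ δ → X} {P : ∀ δ, Measure (Ωδ δ)} {Z : Ω' → X}
    {P' : Measure Ω'} [IsProbabilityMeasure P'] (hP : ∀ δ, P δ = 0 ∨ IsProbabilityMeasure (P δ))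
    (hY : ∀ δ, AEMeasurable (Y δ) (P δ)) (hY' : ∀ δ, AEMeasurable (Y' δ) (P δ))
    (hZ : AEMeasurable Z P') {ε : ℝ → ℝ} (hε : Tendsto ε (𝓝[>] 0) (𝓝 0))
    (hd : ∀ δ ω, dist (Y δ ω) (Y' δ ω) ≤ ε δ) (h : TendstoLaw Y' P Z P') :
    TendstoLaw Y P Z P' := by
  classical
  -- Step 1: `P δ` is eventually a probability measure (test `Y' δ → Z` against the constant `1`).
  have hev : ∀ᶠ δ in 𝓝[>] (0 : ℝ), IsProbabilityMeasure (P δ) := by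
    have h1 := h (BoundedContinuousFunction.const X 1)
    simp only [BoundedContinuousFunction.const_apply, integral_const, smul_eq_mul, mul_one,
      probReal_univ] at h1
    filter_upwards [h1.eventually (lt_mem_nhds one_half_lt_one)] with δ hδ
    rcases hP δ with h0 | hp
    · rw [h0] at hδ
      norm_num at hδ
    · exact hp
  -- Step 2: bounded Lipschitz test functions.
  have key : ∀ (f : X →ᵇ ℝ) (L : ℝ≥0), LipschitzWith L f →
      Tendsto (fun δ => ∫ ω, f (Y δ ω) ∂P δ) (𝓝[>] 0) (𝓝 (∫ ω, f (Z ω) ∂P')) := by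
    intro f L hL
    have hA := h f
    have hB : Tendsto (fun δ => (∫ ω, f (Y δ ω) ∂P δ) - ∫ ω, f (Y' δ ω) ∂P δ) (𝓝[>] 0)
        (𝓝 0) := by
      have hε' : Tendsto (fun δ => (L : ℝ) * |ε δ|) (𝓝[>] 0) (𝓝 0) := by
        simpa using (tendsto_const_nhds (x := (L : ℝ))).mul hε.abs
      exact squeeze_zero_norm
        (fun δ => norm_integral_sub_integral_le (hP δ) (hY δ) (hY' δ) f hL (hd δ)) hε'
    have := hA.add hB
    rw [add_zero] at this
    exact this.congr fun δ => by ring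
  -- Step 3: package the laws as probability measures on `X` (junk `ν` off the good set).
  let ν : ProbabilityMeasure X := ⟨P'.map Z, Measure.isProbabilityMeasure_map hZ⟩
  let νs : ℝ → ProbabilityMeasure X := fun δ =>
    if hδ : IsProbabilityMeasure (P δ) then ⟨(P δ).map (Y δ), Measure.isProbabilityMeasure_map (hY δ)⟩
    else ν
  have hν_eq : ∀ g : X →ᵇ ℝ, ∫ x, g x ∂(ν : Measure X) = ∫ ω, g (Z ω) ∂P' := fun g =>
    integral_map hZ g.continuous.aestronglyMeasurable
  have hνs_eq : ∀ᶠ δ in 𝓝[>] (0 : ℝ), ∀ g : X →ᵇ ℝ,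
      ∫ x, g x ∂(νs δ : Measure X) = ∫ ω, g (Y δ ω) ∂P δ := by
    filter_upwards [hev] with δ hδ g
    simp only [νs, dif_pos hδ, ProbabilityMeasure.coe_mk]
    exact integral_map (hY δ) g.continuous.aestronglyMeasurable
  -- Step 4: weak convergence of the packaged laws, by the bounded-Lipschitz criterion.
  have hT : Tendsto νs (𝓝[>] 0) (𝓝 ν) := by
    rw [tendsto_iff_forall_lipschitz_integral_tendsto]
    intro f hfb hfL
    obtain ⟨L, hL⟩ := hfL
    let fb : X →ᵇ ℝ := ⟨⟨f, hL.continuous⟩, hfb⟩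
    have h1 : Tendsto (fun δ => ∫ ω, f (Y δ ω) ∂P δ) (𝓝[>] 0) (𝓝 (∫ ω, f (Z ω) ∂P')) :=
      key fb L hL
    have e1 : (fun δ => ∫ ω, f (Y δ ω) ∂P δ) =ᶠ[𝓝[>] 0] fun δ => ∫ x, f x ∂(νs δ : Measure X) :=
      hνs_eq.mono fun δ hδ => (hδ fb).symm
    have e2 : ∫ x, f x ∂(ν : Measure X) = ∫ ω, f (Z ω) ∂P' := hν_eq fb
    rw [e2]
    exact h1.congr' e1
  -- Step 5: all bounded continuous test functions.
  intro g
  have hg := (ProbabilityMeasure.tendsto_iff_forall_integral_tendsto.1 hT) g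
  rw [hν_eq g] at hg
  exact hg.congr' (hνs_eq.mono fun δ hδ => hδ g)

end Summit.CriticalPhenomena.SAWScalingLimit.Cruxes.HexTransfer.Sketch.PortTransfer

end
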